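import Literature.NumberTheory.Transcendental.SixExponentialsSeveralVariablesAuxiliary
import Literature.NumberTheory.Transcendental.SixExponentialsSeveralVariablesProp61Proofs
import Literature.NumberTheory.Transcendental.AlgebraicGeneratorsField
import HarnessLib

/-!
# Waldschmidt 1981, Corollaire 4.2 from Théorème 4.1 (the Liouville step of §4, proved)

Topic `Literature/NumberTheory/Transcendental`; sibling proof file of
`SixExponentialsSeveralVariablesSteps.lean` (the named facts `cor_3_2`, `thm_4_1`, `cor_4_2`, … of
[Waldschmidt1981] §§3–6). Everything here is PROVED; there are no new definitions and no new
facts. The main result is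

`cor_4_2_of_thm_4_1 : thm_4_1 → cor_4_2`,

i.e. **Corollaire 4.2** (p. 105: "Si les nombres `exp⟨xᵢ, yⱼ⟩` `(1 ≤ i ≤ d, 1 ≤ j ≤ ℓ)` sont tous
algébriques, et si `d > n`, alors `χ(Y, X) ≤ n/(d − n)`") follows from **Théorème 4.1** (Masser's
zero estimate, [Masser1981, Theorem 2], the tree's named fact `Waldschmidt1981.thm_4_1`) by the
printed twelve-line argument of p. 105, whose other two inputs are in the tree: **Corollaire 3.2**
(the auxiliary polynomials `P_N`, `cor_3_2_holds`, `SixExponentialsSeveralVariablesAuxiliary.lean`)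
and **Liouville's inequality** in the number field `K = ℚ(exp⟨xᵢ, yⱼ⟩)` (`AlgGens`,
`AlgebraicGeneratorsField.lean`). With the chain already proved
(`SixExponentialsSeveralVariablesChainProofs.lean`: `thm_1_1_of_cor_4_2`, `thm_2_1_of_cor_4_2`;
`prop_6_1_of_cor_4_2`, `lem_5_1_holds`, `cor_3_2_holds`), the only un-discharged input below
Théorèmes 1.1 and 2.1 of [Waldschmidt1981] (and Roy's quotation
`Literature.Barriers.Schanuel.waldschmidt1981_linearSubgroup_matrix`) is now Masser's zero estimate
`thm_4_1` itself: `cor_4_2_holds := cor_4_2_of_thm_4_1 thm_4_1_holds`.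

## The printed proof (p. 105) and its rendering

> "Quitte à multiplier tous les `xᵢ` par `∑|yⱼ|` et à diviser tous les `yⱼ` par ce même nombre, on
> peut supposer `∑|yⱼ| = 1`, de sorte que `Y_N` soit contenu dans `B(0, N)`. Comme le degré total du
> polynôme `P_N` (construit au corollaire 3.2) est majoré par `dN^{n/(d−n)}(log N)^{n+2}`, il suffit
> de vérifier que les nombres `F_N(y)`, `(y ∈ Y_N)` sont nuls quand `N` est suffisamment grand.
> Notons `α_{ij} = exp⟨xᵢ, yⱼ⟩` et, pour `N` suffisamment grand, `S = N^{d/(d−n)}(log N)^{n+2}`,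
> `U = N^{d/(d−n)}(log N)^{d+2}`. Soit `y = m₁y₁ + … + m_ℓ y_ℓ ∈ Y_N`. On a
> `F_N(y) = ∑_λ p(λ) ∏ᵢ ∏ⱼ α_{ij}^{λᵢ mⱼ}`. Les conjugués de `F_N(y)` sur `ℚ` ont un module majoré
> par `exp(c₁S)` … Comme `|F_N(y)| ≤ e^{−U}` … la norme de `F_N(y)` sur `ℚ` … est un nombre
> rationnel dont un dénominateur est majoré par `exp(c₂S)`. Comme `U > 2c₂S` pour `N`
> suffisamment grand, on en déduit `F_N(y) = 0`."

* Instead of rescaling `x`, `y` (which would require the invariance of `χ`), we keep `x`, `y` and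
  apply Théorème 4.1 on `Y_M` with `M = ⌊N/c'⌋`, `c' = 1 + ∑ⱼ‖yⱼ‖`, so that `Y_M ⊆ B(0, N)`
  (sup norm, as in `cor_3_2`); `M ≥ N/(2c')` costs a constant factor only.
* The norm argument is packaged as Liouville's inequality for the algebraic integer
  `den^e · Q(α)` (`AlgGens.aeval_eq_zero_of_norm_lt`), where `Q = P_N(∏ⱼ T_{ij}^{mⱼ}) ∈ ℤ[T_{ij}]`
  is the substituted polynomial (`MvPolynomial.bind₁` of monic monomials): total degree
  `e ≤ deg P_N · ∑mⱼ ≤ dℓS` (`totalDegree_bind₁_le`), length `≤` length of `P_N` `≤ e^{(d+1)S}`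
  (`l1_bind₁_monomial_le`, `card_support_le_prod_degreeOf`), whence the threshold `exp(−h C₁ S)`,
  `C₁ = dℓ(log|den| + log M) + d + 1` independent of `N` (`vanish_of_large`).
* `deg P_N ≥ 1` (needed by Théorème 4.1) because a non-zero constant integer polynomial has no
  value of modulus `< 1` (`one_le_totalDegree_map`); the final limiting argument
  "`(⌊N/c'⌋/d)^χ ≤ dN^{n/(d−n)}(log N)^{n+2}` for all large `N` forces `χ ≤ n/(d−n)`", implicit in
  the source, is `not_forall_rpow_le` (Mathlib's `isLittleO_log_rpow_rpow_atTop`).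

## References

* [Waldschmidt1981] M. Waldschmidt, *Transcendance et exponentielles en plusieurs variables*,
  Invent. Math. 63 (1981) 97–127, doi:10.1007/bf01389195: §4 Théorème 4.1, Corollaire 4.2 and its
  proof (p. 105). Read on the open GDZ scan PPN356556735_0063, LOG_0012.
* [Masser1981] D. W. Masser, *On polynomials and exponential polynomials in several complex
  variables*, Invent. Math. 63 (1981) 81–95, Theorem 2 (pp. 82–83).
* [Baker1975] A. Baker, *Transcendental Number Theory*, CUP 1975, Ch. 2, Lemma 3 (the Liouville /
  norm inequality pattern of `AlgGens`).
-/

noncomputable section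

open Complex Finset MvPolynomial NumberField

namespace Literature.NumberTheory.Transcendental

namespace AlgGens

/-! ### Liouville's inequality for a polynomial in the generators of a number field -/

/-- The value of an integer polynomial at the generators, computed in `K`, is the complex value.
[folklore] -/
theorem coe_aeval_genK (G : AlgGens) (Q : MvPolynomial G.ι ℤ) :
    ((aeval G.genK Q : G.K) : ℂ) = aeval G.a Q := by
  induction Q using MvPolynomial.induction_on with
  | C a => simp
  | add p q hp hq => simp [hp, hq]
  | mul_X p i hp => simp [hp]

/-- **Liouville's inequality** for `Q(a)`, `Q ∈ ℤ[Tᵢ]` of total degree `≤ e` and length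
`∑|coeff| ≤ L` (`L ≥ 1`), `a` the generators of `K = ℚ(aᵢ)`: if
`|Q(a)| < (|d|^e · L · M^e)^{-h}` then `Q(a) = 0` (`d` the common denominator, `M` the bound for
the conjugates of the generators, `h = [K:ℚ]`). [cite: Baker1975, Ch. 2 Lemma 3] -/
theorem aeval_eq_zero_of_norm_lt (G : AlgGens) (Q : MvPolynomial G.ι ℤ) {e : ℕ}
    (he : Q.totalDegree ≤ e) {L : ℝ} (hL : ∑ s ∈ Q.support, |((Q.coeff s : ℤ) : ℝ)| ≤ L)
    (hL1 : 1 ≤ L)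
    (hlt : ‖aeval G.a Q‖ < ((|(G.den : ℝ)| ^ e * L * G.M ^ e) ^ G.h)⁻¹) : aeval G.a Q = 0 := by
  by_contra hne
  set ξ : G.K := aeval G.genK Q with hξdef
  have hξ : (ξ : ℂ) = aeval G.a Q := G.coe_aeval_genK Q
  set x0 : 𝓞 G.K := ⟨(G.den : G.K) ^ e * ξ, G.isIntegral_den_pow_mul_aeval Q he⟩ with hx0def
  have hx0coe : ((x0 : G.K) : ℂ) = (G.den : ℂ) ^ e * aeval G.a Q := by
    simp only [hx0def, RingOfIntegers.map_mk]
    push_cast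
    rw [hξ]
  have hden0 : (G.den : ℂ) ≠ 0 := by exact_mod_cast G.den_ne_zero
  have hx0 : x0 ≠ 0 := by
    intro h0
    have : ((x0 : G.K) : ℂ) = 0 := by rw [h0]; rfl
    rw [hx0coe] at this
    exact hne ((mul_eq_zero.1 this).resolve_left (pow_ne_zero _ hden0))
  set B : ℝ := |(G.den : ℝ)| ^ e * L * G.M ^ e with hBdef
  have hd1 : (1 : ℝ) ≤ |(G.den : ℝ)| := G.one_le_abs_den
  have hM1 : (1 : ℝ) ≤ G.M := G.one_le_M
  have hde1 : (1 : ℝ) ≤ |(G.den : ℝ)| ^ e := one_le_pow₀ hd1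
  have hB1 : 1 ≤ B :=
    one_le_mul_of_one_le_of_one_le (one_le_mul_of_one_le_of_one_le hde1 hL1) (one_le_pow₀ hM1)
  have hBpos : 0 < B := by linarith
  have hconj : ∀ σ : G.K →+* ℂ, ‖σ (x0 : G.K)‖ ≤ B := by
    intro σ
    simp only [hx0def, RingOfIntegers.map_mk, map_mul, map_pow, map_intCast, norm_mul, norm_pow,
      Complex.norm_intCast]
    have h1 := G.norm_embedding_aeval_le σ Q he
    calc |(G.den : ℝ)| ^ e * ‖σ ξ‖ ≤ |(G.den : ℝ)| ^ e * (L * G.M ^ e) := by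
          refine mul_le_mul_of_nonneg_left (h1.trans ?_) (by positivity)
          exact mul_le_mul_of_nonneg_right hL (by positivity)
      _ = B := by rw [hBdef]; ring
  have hlow : (B ^ (G.h - 1))⁻¹ ≤ ‖((x0 : G.K) : ℂ)‖ := G.norm_ge_of_forall_norm_le hx0 hB1 hconj
  rw [hx0coe, norm_mul, norm_pow, Complex.norm_intCast] at hlow
  -- `(B^h)⁻¹ ≤ (B^(h-1))⁻¹ / |d|^e ≤ ‖Q(a)‖`, contradiction
  have hh : G.h = (G.h - 1) + 1 := (Nat.sub_add_cancel G.one_le_h).symm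
  have hBh : B ^ G.h = B ^ (G.h - 1) * B := by rw [hh, pow_succ, Nat.add_sub_cancel]
  have hkey : (B ^ G.h)⁻¹ ≤ ‖aeval G.a Q‖ := by
    rw [hBh, mul_inv]
    have hBinv : B⁻¹ ≤ (|(G.den : ℝ)| ^ e)⁻¹ := by
      refine inv_anti₀ (by positivity) ?_
      calc |(G.den : ℝ)| ^ e = |(G.den : ℝ)| ^ e * 1 * 1 := by ring
        _ ≤ |(G.den : ℝ)| ^ e * L * G.M ^ e := by gcongr; exact one_le_pow₀ hM1
    calc (B ^ (G.h - 1))⁻¹ * B⁻¹ ≤ (B ^ (G.h - 1))⁻¹ * (|(G.den : ℝ)| ^ e)⁻¹ :=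
          mul_le_mul_of_nonneg_left hBinv (by positivity)
      _ ≤ (|(G.den : ℝ)| ^ e * ‖aeval G.a Q‖) * (|(G.den : ℝ)| ^ e)⁻¹ :=
          mul_le_mul_of_nonneg_right hlow (by positivity)
      _ = ‖aeval G.a Q‖ := by field_simp
  exact absurd hlt (not_lt.mpr hkey)

end AlgGens

namespace Waldschmidt1981

/-! ### Polynomial bookkeeping: substitution of monomials, length, support -/

section Poly

variable {σ τ R : Type*} [CommSemiring R]

/-- `deg (bind₁ g P) ≤ deg P · k` when every `g i` has total degree `≤ k`. [folklore] -/
theorem totalDegree_bind₁_le (g : σ → MvPolynomial τ R) {k : ℕ}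
    (hg : ∀ i, (g i).totalDegree ≤ k) (P : MvPolynomial σ R) :
    (bind₁ g P).totalDegree ≤ P.totalDegree * k := by
  classical
  conv_lhs => rw [P.as_sum]
  rw [map_sum]
  refine totalDegree_finsetSum_le fun s hs => ?_
  rw [bind₁_monomial]
  refine (totalDegree_mul _ _).trans ?_
  rw [totalDegree_C, zero_add]
  refine (totalDegree_finsetProd _ _).trans ?_
  calc ∑ i ∈ s.support, (g i ^ s i).totalDegree ≤ ∑ i ∈ s.support, s i * k :=
        Finset.sum_le_sum fun i _ => (totalDegree_pow _ _).trans (Nat.mul_le_mul_left _ (hg i))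
    _ = (s.sum fun _ e => e) * k := by rw [Finsupp.sum, Finset.sum_mul]
    _ ≤ P.totalDegree * k := Nat.mul_le_mul_right _ (le_totalDegree hs)

/-- Substituting monic monomials into a monomial gives a monomial. [folklore] -/
theorem bind₁_monomial_monomial (v : σ → τ →₀ ℕ) (s : σ →₀ ℕ) (r : R) :
    bind₁ (fun i => monomial (v i) (1 : R)) (monomial s r) =
      monomial (s.sum fun i k => k • v i) r := by
  rw [bind₁_monomial, Finsupp.sum, monomial_sum_index]
  congr 1
  exact Finset.prod_congr rfl fun i _ => by rw [monomial_pow, one_pow]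

/-- The total degree of a monic monomial `T^{v}` with `v = ∑ⱼ mⱼ e_{kⱼ}` is at most `∑ⱼ mⱼ`.
[folklore] -/
theorem totalDegree_monomial_sum_single_le {ι : Type*} (S : Finset ι) (k : ι → τ) (m : ι → ℕ) :
    (monomial (∑ j ∈ S, Finsupp.single (k j) (m j)) (1 : R)).totalDegree ≤ ∑ j ∈ S, m j := by
  classical
  refine (totalDegree_monomial_le _ _).trans (le_of_eq ?_)
  rw [← Finsupp.sum_finsetSum_index (fun _ => rfl) (fun _ _ _ => rfl)]
  exact Finset.sum_congr rfl fun j _ => Finsupp.sum_single_index rfl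

/-- Evaluating the monic monomial `T^{v}`, `v = ∑ⱼ mⱼ e_{kⱼ}`, gives `∏ⱼ f(kⱼ)^{mⱼ}`. [folklore] -/
theorem aeval_monomial_sum_single {ι S₁ : Type*} [CommSemiring S₁] [Algebra R S₁] (S : Finset ι)
    (k : ι → τ) (m : ι → ℕ) (f : τ → S₁) :
    aeval f (monomial (∑ j ∈ S, Finsupp.single (k j) (m j)) (1 : R)) = ∏ j ∈ S, f (k j) ^ m j := by
  classical
  rw [aeval_monomial, map_one, one_mul,
    ← Finsupp.prod_finsetSum_index (fun _ => pow_zero _) (fun _ _ _ => pow_add _ _ _)]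
  exact Finset.prod_congr rfl fun j _ => Finsupp.prod_single_index (pow_zero _)

/-- `∑_{μ ∈ T} |coeff μ Q| ≤ ∑_{μ ∈ supp Q} |coeff μ Q|` for any finite set `T` of exponents.
[folklore] -/
theorem sum_abs_coeff_le_sum_support (Q : MvPolynomial τ ℤ) (T : Finset (τ →₀ ℕ)) :
    ∑ μ ∈ T, |((Q.coeff μ : ℤ) : ℝ)| ≤ ∑ μ ∈ Q.support, |((Q.coeff μ : ℤ) : ℝ)| := by
  classical
  rw [← Finset.sum_filter_ne_zero T]
  refine Finset.sum_le_sum_of_subset_of_nonneg (fun μ hμ => ?_) (fun _ _ _ => abs_nonneg _)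
  rw [Finset.mem_filter] at hμ
  rw [mem_support_iff]
  intro h0
  exact hμ.2 (by simp [h0])

/-- The length `∑|coeff|` is subadditive. [folklore] -/
theorem l1_add_le (Q₁ Q₂ : MvPolynomial τ ℤ) :
    ∑ μ ∈ (Q₁ + Q₂).support, |(((Q₁ + Q₂).coeff μ : ℤ) : ℝ)| ≤
      ∑ μ ∈ Q₁.support, |((Q₁.coeff μ : ℤ) : ℝ)| + ∑ μ ∈ Q₂.support, |((Q₂.coeff μ : ℤ) : ℝ)| :=
  calc ∑ μ ∈ (Q₁ + Q₂).support, |(((Q₁ + Q₂).coeff μ : ℤ) : ℝ)|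
      ≤ ∑ μ ∈ (Q₁ + Q₂).support, (|((Q₁.coeff μ : ℤ) : ℝ)| + |((Q₂.coeff μ : ℤ) : ℝ)|) :=
        Finset.sum_le_sum fun μ _ => by rw [coeff_add]; push_cast; exact abs_add_le _ _
    _ = ∑ μ ∈ (Q₁ + Q₂).support, |((Q₁.coeff μ : ℤ) : ℝ)| +
          ∑ μ ∈ (Q₁ + Q₂).support, |((Q₂.coeff μ : ℤ) : ℝ)| := Finset.sum_add_distrib
    _ ≤ _ := add_le_add (sum_abs_coeff_le_sum_support Q₁ _) (sum_abs_coeff_le_sum_support Q₂ _)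

/-- The length of a monomial is at most the modulus of its coefficient. [folklore] -/
theorem l1_monomial_le (μ : τ →₀ ℕ) (c : ℤ) :
    ∑ ν ∈ (monomial μ c).support, |(((monomial μ c).coeff ν : ℤ) : ℝ)| ≤ |(c : ℝ)| := by
  classical
  rcases eq_or_ne c 0 with rfl | hc
  · simp
  · rw [support_monomial, if_neg hc, Finset.sum_singleton, coeff_monomial, if_pos rfl]

/-- The length of a sum of monomials is at most the sum of the moduli of the coefficients.
[folklore] -/
theorem l1_sum_monomial_le {α : Type*} (S : Finset α) (φ : α → τ →₀ ℕ) (c : α → ℤ) :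
    ∑ ν ∈ (∑ a ∈ S, monomial (φ a) (c a)).support,
        |(((∑ a ∈ S, monomial (φ a) (c a)).coeff ν : ℤ) : ℝ)| ≤ ∑ a ∈ S, |(c a : ℝ)| := by
  classical
  induction S using Finset.induction_on with
  | empty => simp
  | insert a S ha ih =>
    rw [Finset.sum_insert ha, Finset.sum_insert ha]
    exact (l1_add_le _ _).trans (add_le_add (l1_monomial_le _ _) ih)

/-- **The length does not increase under substitution of monic monomials.** [folklore] -/
theorem l1_bind₁_monomial_le (v : σ → τ →₀ ℕ) (P : MvPolynomial σ ℤ) :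
    ∑ ν ∈ (bind₁ (fun i => monomial (v i) (1 : ℤ)) P).support,
        |(((bind₁ (fun i => monomial (v i) (1 : ℤ)) P).coeff ν : ℤ) : ℝ)| ≤
      ∑ s ∈ P.support, |((P.coeff s : ℤ) : ℝ)| := by
  classical
  have hQ : bind₁ (fun i => monomial (v i) (1 : ℤ)) P =
      ∑ s ∈ P.support, monomial (s.sum fun i k => k • v i) (P.coeff s) := by
    conv_lhs => rw [P.as_sum]
    rw [map_sum]
    exact Finset.sum_congr rfl fun s _ => bind₁_monomial_monomial v s _
  rw [hQ]
  exact l1_sum_monomial_le _ _ _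

/-- A non-zero integer polynomial has length at least `1`. [folklore] -/
theorem one_le_l1_of_ne_zero (P : MvPolynomial σ ℤ) (hP : P ≠ 0) :
    (1 : ℝ) ≤ ∑ s ∈ P.support, |((P.coeff s : ℤ) : ℝ)| := by
  have hne : P.support.Nonempty := by
    rw [Finset.nonempty_iff_ne_empty, Ne, support_eq_empty]
    exact hP
  obtain ⟨s, hs⟩ := hne
  have h1 : (1 : ℝ) ≤ |((P.coeff s : ℤ) : ℝ)| := by
    rw [← Int.cast_abs]
    exact_mod_cast Int.one_le_abs (mem_support_iff.mp hs)
  exact h1.trans (Finset.single_le_sum (f := fun s => |((P.coeff s : ℤ) : ℝ)|)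
    (fun _ _ => abs_nonneg _) hs)

/-- `#supp P ≤ ∏ᵢ (deg_{Tᵢ} P + 1)`. [folklore] -/
theorem card_support_le_prod_degreeOf {d : ℕ} (P : MvPolynomial (Fin d) R) :
    P.support.card ≤ ∏ i, (P.degreeOf i + 1) := by
  classical
  have h : P.support.card ≤ (Fintype.piFinset fun i => Finset.range (P.degreeOf i + 1)).card := by
    refine Finset.card_le_card_of_injOn (fun s => ⇑s) ?_ ?_
    · intro s hs
      rw [Finset.mem_coe] at hs
      rw [Finset.mem_coe, Fintype.mem_piFinset]
      intro i
      rw [Finset.mem_range, Nat.lt_succ_iff]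
      exact monomial_le_degreeOf i hs
    · intro s _ t _ hst
      exact DFunLike.coe_injective hst
  simpa [Fintype.card_piFinset, Finset.card_range] using h

/-- `deg P ≤ ∑ᵢ deg_{Tᵢ} P`. [folklore] -/
theorem totalDegree_le_sum_degreeOf {d : ℕ} (P : MvPolynomial (Fin d) R) :
    P.totalDegree ≤ ∑ i, P.degreeOf i := by
  rw [totalDegree]
  refine Finset.sup_le fun s hs => ?_
  rw [Finsupp.sum_fintype _ _ (fun _ => rfl)]
  exact Finset.sum_le_sum fun i _ => monomial_le_degreeOf i hs

end Poly

/-! ### Points of `Y_N` and the values `F_N(y)` -/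

/-- `exp⟨u, ∑ⱼ mⱼ yⱼ⟩ = ∏ⱼ exp⟨u, yⱼ⟩^{mⱼ}`. [folklore] -/
theorem cexp_dotProduct_sum_smul {n l : ℕ} (u : Fin n → ℂ) (y : Fin l → Fin n → ℂ)
    (m : Fin l → ℕ) : cexp (u ⬝ᵥ ∑ j, (m j : ℂ) • y j) = ∏ j, cexp (u ⬝ᵥ y j) ^ (m j) := by
  rw [dotProduct_sum, Complex.exp_sum]
  refine Finset.prod_congr rfl fun j _ => ?_
  rw [dotProduct_smul, smul_eq_mul, ← Complex.exp_nat_mul]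

/-- `‖∑ⱼ mⱼ yⱼ‖ ≤ M ∑ⱼ ‖yⱼ‖` for `0 ≤ mⱼ ≤ M`. [folklore] -/
theorem norm_sum_smul_le {n l : ℕ} (y : Fin l → Fin n → ℂ) {M : ℕ} (m : Fin l → ℕ)
    (hm : ∀ j, m j ≤ M) : ‖∑ j, (m j : ℂ) • y j‖ ≤ M * ∑ j, ‖y j‖ :=
  calc ‖∑ j, (m j : ℂ) • y j‖ ≤ ∑ j, ‖(m j : ℂ) • y j‖ := norm_sum_le _ _
    _ ≤ ∑ j, (M : ℝ) * ‖y j‖ := Finset.sum_le_sum fun j _ => by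
        rw [norm_smul, Complex.norm_natCast]
        exact mul_le_mul_of_nonneg_right (by exact_mod_cast hm j) (norm_nonneg _)
    _ = M * ∑ j, ‖y j‖ := by rw [Finset.mul_sum]


/-- `P(e^{⟨xᵢ,z⟩})` computed through `ℂ[T]` (as in Théorème 4.1) or through `ℤ[T]` (as in
Corollaire 3.2) is the same number. [folklore] -/
theorem eval_map_intCast {d : ℕ} {S : Type*} [CommRing S] (f : Fin d → S)
    (P : MvPolynomial (Fin d) ℤ) : eval f (map (Int.castRingHom S) P) = aeval f P := by
  rw [eval_map, aeval_def, algebraMap_int_eq]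

/-- **`F_N(y) = 0` by Liouville** (p. 105: "les conjugués de `F_N(y)` … la norme de `F_N(y)` sur
`ℚ` … on en déduit `F_N(y) = 0`"), abstract form: `F_N(y) = Q(α)` for the substituted polynomial
`Q = P_N(∏ⱼ T_{ij}^{mⱼ})`, of total degree `≤ e` and length `≤ L`, so Liouville's inequality for
`Q(α)` applies. [cite: Waldschmidt1981, §4 proof of Corollaire 4.2 (p. 105)] -/
theorem aeval_point_eq_zero {n d l : ℕ} (x : Fin d → Fin n → ℂ) (y : Fin l → Fin n → ℂ)
    (G : AlgGens) (idx : Fin d → Fin l → G.ι) (hidx : ∀ i j, G.a (idx i j) = cexp (x i ⬝ᵥ y j))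
    (P : MvPolynomial (Fin d) ℤ) (m : Fin l → ℕ) {e : ℕ} (he : P.totalDegree * ∑ j, m j ≤ e)
    {L : ℝ} (hL : ∑ s ∈ P.support, |((P.coeff s : ℤ) : ℝ)| ≤ L) (hL1 : 1 ≤ L)
    (hlt : ‖aeval (fun i => cexp (x i ⬝ᵥ ∑ j, (m j : ℂ) • y j)) P‖ <
      ((|(G.den : ℝ)| ^ e * L * G.M ^ e) ^ G.h)⁻¹) :
    aeval (fun i => cexp (x i ⬝ᵥ ∑ j, (m j : ℂ) • y j)) P = 0 := by
  classical
  obtain ⟨v, hv⟩ : ∃ v : Fin d → G.ι →₀ ℕ, ∀ i, v i = ∑ j, Finsupp.single (idx i j) (m j) :=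
    ⟨_, fun _ => rfl⟩
  set Q : MvPolynomial G.ι ℤ := bind₁ (fun i => monomial (v i) (1 : ℤ)) P with hQ
  have hfun : ∀ i, aeval G.a (monomial (v i) (1 : ℤ)) = cexp (x i ⬝ᵥ ∑ j, (m j : ℂ) • y j) := by
    intro i
    rw [hv i, aeval_monomial_sum_single, cexp_dotProduct_sum_smul]
    exact Finset.prod_congr rfl fun j _ => by rw [hidx]
  have hQP : aeval G.a Q = aeval (fun i => cexp (x i ⬝ᵥ ∑ j, (m j : ℂ) • y j)) P := by
    rw [hQ, aeval_bind₁]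
    exact congrArg (fun f => aeval f P) (funext hfun)
  have hQdeg : Q.totalDegree ≤ e := by
    refine (totalDegree_bind₁_le _ (k := ∑ j, m j) (fun i => ?_) P).trans he
    rw [hv i]
    exact totalDegree_monomial_sum_single_le _ _ _
  have hQL : ∑ s ∈ Q.support, |((Q.coeff s : ℤ) : ℝ)| ≤ L := (l1_bind₁_monomial_le v P).trans hL
  rw [← hQP] at hlt ⊢
  exact G.aeval_eq_zero_of_norm_lt Q hQdeg hQL hL1 hlt

/-- **The vanishing of `F_N` on `Y_M` for `N` large** (p. 105), quantitative form. With
`S = N^{d/(d−n)}(log N)^{n+2}`, `U = N^{d/(d−n)}(log N)^{d+2}` and `P_N` as in Corollaire 3.2: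
the substituted polynomial has total degree `e ≤ dℓS` and length `≤ e^{(d+1)S}`, so the
Liouville bound is `exp(−h·C₁·S)` with `C₁ = dℓ(log|den| + log M) + d + 1` independent of `N`,
while `|F_N(y)| ≤ e^{−U}` and `U = S (log N)^{d−n} > h C₁ S` as soon as `log N > h C₁`.
[cite: Waldschmidt1981, §4 proof of Corollaire 4.2 (p. 105)] -/
theorem vanish_of_large {n d l : ℕ} (x : Fin d → Fin n → ℂ) (y : Fin l → Fin n → ℂ) (hnd : n < d)
    (G : AlgGens) (idx : Fin d → Fin l → G.ι) (hidx : ∀ i j, G.a (idx i j) = cexp (x i ⬝ᵥ y j))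
    {N : ℕ} (hN3 : (3 : ℝ) ≤ N) (P : MvPolynomial (Fin d) ℤ) (hP0 : P ≠ 0)
    (hdeg : ∀ i, (P.degreeOf i : ℝ) < (N : ℝ) ^ ((n : ℝ) / (d - n)) * Real.log N ^ (n + 2))
    (hcoef : ∀ s ∈ P.support,
      Real.log |((P.coeff s : ℤ) : ℝ)| ≤ (N : ℝ) ^ ((d : ℝ) / (d - n)) * Real.log N ^ (n + 2))
    (hsmall : ∀ z : Fin n → ℂ, ‖z‖ ≤ N → ‖aeval (fun i => cexp (x i ⬝ᵥ z)) P‖ ≤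
      Real.exp (-((N : ℝ) ^ ((d : ℝ) / (d - n)) * Real.log N ^ (d + 2))))
    (hC : G.h * (d * l * (Real.log |(G.den : ℝ)| + Real.log G.M) + (d + 1)) < Real.log N)
    {M : ℕ} (hMN : (M : ℝ) ≤ N) (hMy : (M : ℝ) * ∑ j, ‖y j‖ ≤ N)
    (m : Fin l → ℕ) (hm : ∀ j, m j ≤ M) :
    aeval (fun i => cexp (x i ⬝ᵥ ∑ j, (m j : ℂ) • y j)) P = 0 := by
  -- basic quantities
  have hN1 : (1 : ℝ) ≤ N := by linarith
  have hNpos : (0 : ℝ) < N := by linarith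
  have hlog1 : 1 ≤ Real.log N := by
    rw [Real.le_log_iff_exp_le hNpos]
    have := Real.exp_one_lt_d9
    linarith
  have hlog0 : 0 ≤ Real.log N := zero_le_one.trans hlog1
  have hdn0 : (0 : ℝ) < (d : ℝ) - n := by
    have : (n : ℝ) < d := by exact_mod_cast hnd
    linarith
  set A : ℝ := (N : ℝ) ^ ((n : ℝ) / (d - n)) with hA
  set Bp : ℝ := (N : ℝ) ^ ((d : ℝ) / (d - n)) with hBp
  have hA1 : 1 ≤ A := Real.one_le_rpow hN1 (div_nonneg (Nat.cast_nonneg _) hdn0.le)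
  have hBA : Bp = N * A := by
    have hexp : (d : ℝ) / (d - n) = (n : ℝ) / (d - n) + 1 := by
      rw [div_add_one hdn0.ne']; congr 1; ring
    rw [hBp, hA, hexp, Real.rpow_add_one hNpos.ne', mul_comm]
  set D₀ : ℝ := A * Real.log N ^ (n + 2) with hD₀
  have hD₀1 : 1 ≤ D₀ := one_le_mul_of_one_le_of_one_le hA1 (one_le_pow₀ hlog1)
  set S : ℝ := Bp * Real.log N ^ (n + 2) with hS
  have hS' : S = N * D₀ := by rw [hS, hBA, hD₀]; ring
  have hD₀S : D₀ ≤ S := by rw [hS']; exact le_mul_of_one_le_left (by linarith) hN1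
  have hS1 : 1 ≤ S := hD₀1.trans hD₀S
  have hSpos : 0 < S := by linarith
  set U : ℝ := Bp * Real.log N ^ (d + 2) with hU
  have hU' : U = S * Real.log N ^ (d - n) := by
    rw [hU, hS, mul_assoc, ← pow_add]
    congr 2; omega
  -- the degree `e` of the substituted polynomial
  have hdegsum : (P.totalDegree : ℝ) ≤ d * D₀ :=
    calc (P.totalDegree : ℝ) ≤ ∑ i, (P.degreeOf i : ℝ) := by
          exact_mod_cast totalDegree_le_sum_degreeOf P
      _ ≤ ∑ _i : Fin d, D₀ := Finset.sum_le_sum fun i _ => (hdeg i).le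
      _ = d * D₀ := by rw [Finset.sum_const, Finset.card_univ, Fintype.card_fin, nsmul_eq_mul]
  have hmsum : ((∑ j, m j : ℕ) : ℝ) ≤ l * M := by
    push_cast
    calc ∑ j, (m j : ℝ) ≤ ∑ _j : Fin l, (M : ℝ) := Finset.sum_le_sum fun j _ => by
          exact_mod_cast hm j
      _ = l * M := by rw [Finset.sum_const, Finset.card_univ, Fintype.card_fin, nsmul_eq_mul]
  set e : ℕ := P.totalDegree * ∑ j, m j with he
  have he_le : (e : ℝ) ≤ d * l * S := by
    rw [he, Nat.cast_mul]
    calc (P.totalDegree : ℝ) * ((∑ j, m j : ℕ) : ℝ) ≤ (d * D₀) * (l * M) :=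
          mul_le_mul hdegsum hmsum (Nat.cast_nonneg _) (by positivity)
      _ ≤ (d * D₀) * (l * N) := by gcongr
      _ = d * l * S := by rw [hS']; ring
  -- the length `L`
  set L : ℝ := ∑ s ∈ P.support, |((P.coeff s : ℤ) : ℝ)| with hL
  have hL1 : 1 ≤ L := one_le_l1_of_ne_zero P hP0
  have hcoefS : ∀ s ∈ P.support, |((P.coeff s : ℤ) : ℝ)| ≤ Real.exp S := by
    intro s hs
    have hpos : 0 < |((P.coeff s : ℤ) : ℝ)| :=
      abs_pos.mpr (by exact_mod_cast mem_support_iff.mp hs)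
    calc |((P.coeff s : ℤ) : ℝ)| = Real.exp (Real.log |((P.coeff s : ℤ) : ℝ)|) :=
          (Real.exp_log hpos).symm
      _ ≤ Real.exp S := Real.exp_le_exp.mpr (hcoef s hs)
  have hcard : (P.support.card : ℝ) ≤ Real.exp (d * D₀) := by
    have h1 := card_support_le_prod_degreeOf P
    calc (P.support.card : ℝ) ≤ ((∏ i, (P.degreeOf i + 1) : ℕ) : ℝ) := by exact_mod_cast h1
      _ = ∏ i, ((P.degreeOf i : ℝ) + 1) := by push_cast; rfl
      _ ≤ ∏ _i : Fin d, Real.exp D₀ := by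
          refine Finset.prod_le_prod (fun _ _ => by positivity) fun i _ => ?_
          exact (by linarith [hdeg i] : (P.degreeOf i : ℝ) + 1 ≤ D₀ + 1).trans
            (Real.add_one_le_exp D₀)
      _ = Real.exp (d * D₀) := by
          rw [Finset.prod_const, Finset.card_univ, Fintype.card_fin, ← Real.exp_nat_mul]
  have hLle : L ≤ Real.exp ((d + 1) * S) :=
    calc L ≤ ∑ s ∈ P.support, Real.exp S := Finset.sum_le_sum hcoefS
      _ = P.support.card * Real.exp S := by rw [Finset.sum_const, nsmul_eq_mul]
      _ ≤ Real.exp (d * D₀) * Real.exp S := mul_le_mul_of_nonneg_right hcard (Real.exp_pos _).le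
      _ ≤ Real.exp (d * S) * Real.exp S := by gcongr
      _ = Real.exp ((d + 1) * S) := by rw [← Real.exp_add]; ring_nf
  -- the Liouville lower bound `(B^h)⁻¹ ≥ exp(−h C₁ S)`
  set C₁ : ℝ := d * l * (Real.log |(G.den : ℝ)| + Real.log G.M) + (d + 1) with hC₁
  set B : ℝ := |(G.den : ℝ)| ^ e * L * G.M ^ e with hBdef
  have hden1 : (1 : ℝ) ≤ |(G.den : ℝ)| := G.one_le_abs_den
  have hM1 : (1 : ℝ) ≤ G.M := G.one_le_M
  have hlogden : 0 ≤ Real.log |(G.den : ℝ)| := Real.log_nonneg hden1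
  have hlogM : 0 ≤ Real.log G.M := Real.log_nonneg hM1
  have hBexp : B ≤ Real.exp (C₁ * S) := by
    have h1 : |(G.den : ℝ)| ^ e = Real.exp (e * Real.log |(G.den : ℝ)|) := by
      rw [Real.exp_nat_mul, Real.exp_log (by linarith)]
    have h2 : G.M ^ e = Real.exp (e * Real.log G.M) := by
      rw [Real.exp_nat_mul, Real.exp_log (by linarith)]
    rw [hBdef, h1, h2]
    calc Real.exp (e * Real.log |(G.den : ℝ)|) * L * Real.exp (e * Real.log G.M)
        ≤ Real.exp (e * Real.log |(G.den : ℝ)|) * Real.exp ((d + 1) * S) *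
            Real.exp (e * Real.log G.M) := by gcongr
      _ = Real.exp (e * (Real.log |(G.den : ℝ)| + Real.log G.M) + (d + 1) * S) := by
          rw [← Real.exp_add, ← Real.exp_add]; ring_nf
      _ ≤ Real.exp (C₁ * S) := by
          apply Real.exp_le_exp.mpr
          have h3 : (e : ℝ) * (Real.log |(G.den : ℝ)| + Real.log G.M) ≤
              d * l * S * (Real.log |(G.den : ℝ)| + Real.log G.M) :=
            mul_le_mul_of_nonneg_right he_le (by positivity)
          have h4 : C₁ * S = d * l * S * (Real.log |(G.den : ℝ)| + Real.log G.M) + (d + 1) * S := by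
            rw [hC₁]; ring
          rw [h4]
          linarith
  have hBpos : 0 < B := by
    have : 0 < L := by linarith
    positivity
  have hBh : Real.exp (-(G.h * (C₁ * S))) ≤ (B ^ G.h)⁻¹ := by
    rw [Real.exp_neg]
    apply inv_anti₀ (pow_pos hBpos _)
    calc B ^ G.h ≤ Real.exp (C₁ * S) ^ G.h := pow_le_pow_left₀ hBpos.le hBexp _
      _ = Real.exp (G.h * (C₁ * S)) := by rw [← Real.exp_nat_mul]
  -- the upper bound at the point `y = ∑ mⱼ yⱼ ∈ B(0, N)`
  have hzN : ‖∑ j, (m j : ℂ) • y j‖ ≤ N := (norm_sum_smul_le y m hm).trans hMy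
  have hup := hsmall _ hzN
  have hcmp : G.h * (C₁ * S) < U := by
    rw [hU']
    have h2 : Real.log N ≤ Real.log N ^ (d - n) := le_self_pow₀ hlog1 (by omega)
    calc (G.h : ℝ) * (C₁ * S) = (G.h * C₁) * S := by ring
      _ < Real.log N * S := mul_lt_mul_of_pos_right hC hSpos
      _ ≤ Real.log N ^ (d - n) * S := mul_le_mul_of_nonneg_right h2 hSpos.le
      _ = S * Real.log N ^ (d - n) := mul_comm _ _
  have hlt : ‖aeval (fun i => cexp (x i ⬝ᵥ ∑ j, (m j : ℂ) • y j)) P‖ < (B ^ G.h)⁻¹ :=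
    calc ‖aeval (fun i => cexp (x i ⬝ᵥ ∑ j, (m j : ℂ) • y j)) P‖ ≤ Real.exp (-U) := hup
      _ < Real.exp (-(G.h * (C₁ * S))) := Real.exp_lt_exp.mpr (by linarith)
      _ ≤ (B ^ G.h)⁻¹ := hBh
  exact aeval_point_eq_zero x y G idx hidx P m le_rfl le_rfl hL1 hlt

/-- **`deg P_N ≥ 1`**: a non-zero integer polynomial one of whose values `P(e^{⟨xᵢ,z⟩})` has
modulus `< 1` is not constant. [folklore] -/
theorem one_le_totalDegree_map {n d : ℕ} (x : Fin d → Fin n → ℂ) (P : MvPolynomial (Fin d) ℤ)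
    (hP0 : P ≠ 0) (z : Fin n → ℂ) (hsmall : ‖aeval (fun i => cexp (x i ⬝ᵥ z)) P‖ < 1) :
    1 ≤ (map (Int.castRingHom ℂ) P).totalDegree := by
  by_contra hlt
  rw [not_le, Nat.lt_one_iff, totalDegree_eq_zero_iff_eq_C] at hlt
  have hP' : map (Int.castRingHom ℂ) P ≠ 0 := fun h =>
    hP0 (map_injective (Int.castRingHom ℂ) Int.cast_injective (h.trans (map_zero _).symm))
  have hc : (map (Int.castRingHom ℂ) P).coeff 0 ≠ 0 := by
    intro h0
    apply hP'
    rw [hlt, h0, C_0]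
  rw [coeff_map] at hc
  have hc' : P.coeff 0 ≠ 0 := fun h => hc (by simp [h])
  have hval : aeval (fun i => cexp (x i ⬝ᵥ z)) P = ((P.coeff 0 : ℤ) : ℂ) := by
    rw [← eval_map_intCast, hlt, eval_C, coeff_map]
    simp
  have h1 : (1 : ℝ) ≤ ‖aeval (fun i => cexp (x i ⬝ᵥ z)) P‖ := by
    rw [hval, Complex.norm_intCast, ← Int.cast_abs]
    exact_mod_cast Int.one_le_abs hc'
  linarith

/-- **The final asymptotics** (implicit on p. 105): the inequalities
`(⌊N/c'⌋/d)^χ ≤ d N^θ (log N)^k` for all large integers `N` force `χ ≤ θ`, because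
`(log N)^k = o(N^{χ−θ})`. [folklore] -/
theorem not_forall_rpow_le {χ θ c' dd : ℝ} {k : ℕ} (hθ : 0 ≤ θ) (hθχ : θ < χ) (hc' : 0 < c')
    (hdd : 0 < dd) {N₁ : ℝ} (key : ∀ N : ℕ, N₁ ≤ N →
      (((⌊(N : ℝ) / c'⌋₊ : ℕ) : ℝ) / dd) ^ χ ≤ dd * ((N : ℝ) ^ θ * Real.log N ^ k)) : False := by
  have hχ0 : 0 < χ := lt_of_le_of_lt hθ hθχ
  set ε : ℝ := χ - θ with hε
  have hε0 : 0 < ε := sub_pos.mpr hθχ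
  set K : ℝ := dd * (2 * c' * dd) ^ χ with hK
  have hKpos : 0 < K := by positivity
  have hlo := (isLittleO_log_rpow_rpow_atTop (k : ℝ) hε0).bound (half_pos (inv_pos.mpr hKpos))
  have hev : ∀ᶠ t : ℝ in Filter.atTop, ‖Real.log t ^ (k : ℝ)‖ ≤ K⁻¹ / 2 * ‖t ^ ε‖ ∧
      max N₁ (2 * c') ≤ t ∧ 1 ≤ t :=
    hlo.and ((Filter.eventually_ge_atTop _).and (Filter.eventually_ge_atTop _))
  obtain ⟨N, hb, hN₁, hN1⟩ := (tendsto_natCast_atTop_atTop.eventually hev).exists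
  have hNpos : (0 : ℝ) < N := by linarith
  have hlog0 : 0 ≤ Real.log N := Real.log_nonneg hN1
  have hb' : K * Real.log N ^ k ≤ (N : ℝ) ^ ε / 2 := by
    rw [Real.norm_of_nonneg (Real.rpow_nonneg hlog0 _),
      Real.norm_of_nonneg (Real.rpow_nonneg hNpos.le _), Real.rpow_natCast] at hb
    calc K * Real.log N ^ k ≤ K * (K⁻¹ / 2 * (N : ℝ) ^ ε) := mul_le_mul_of_nonneg_left hb hKpos.le
      _ = (N : ℝ) ^ ε / 2 := by field_simp
  have hfl : (N : ℝ) / (2 * c') ≤ ((⌊(N : ℝ) / c'⌋₊ : ℕ) : ℝ) := by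
    have h1 : (N : ℝ) / c' - 1 < ⌊(N : ℝ) / c'⌋₊ := Nat.sub_one_lt_floor _
    have h2 : 2 * c' ≤ N := (le_max_right _ _).trans hN₁
    have h3 : (N : ℝ) / (2 * c') = N / c' - N / (2 * c') := by field_simp; ring
    have h4 : 1 ≤ (N : ℝ) / (2 * c') := by rw [le_div_iff₀ (by positivity)]; linarith
    linarith
  have hkey := key N ((le_max_left _ _).trans hN₁)
  have hlow : (N : ℝ) ^ χ / (2 * c' * dd) ^ χ ≤ (((⌊(N : ℝ) / c'⌋₊ : ℕ) : ℝ) / dd) ^ χ := by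
    rw [← Real.div_rpow hNpos.le (by positivity)]
    refine Real.rpow_le_rpow (by positivity) ?_ hχ0.le
    rw [div_le_div_iff₀ (by positivity) hdd]
    calc (N : ℝ) * dd = N / (2 * c') * (2 * c' * dd) := by field_simp
      _ ≤ ((⌊(N : ℝ) / c'⌋₊ : ℕ) : ℝ) * (2 * c' * dd) :=
          mul_le_mul_of_nonneg_right hfl (by positivity)
  have h1 : (N : ℝ) ^ χ ≤ K * ((N : ℝ) ^ θ * Real.log N ^ k) := by
    have hpos : 0 < (2 * c' * dd) ^ χ := by positivity
    have h := hlow.trans hkey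
    rw [div_le_iff₀ hpos] at h
    calc (N : ℝ) ^ χ ≤ dd * ((N : ℝ) ^ θ * Real.log N ^ k) * (2 * c' * dd) ^ χ := h
      _ = K * ((N : ℝ) ^ θ * Real.log N ^ k) := by rw [hK]; ring
  have h2 : (N : ℝ) ^ χ = (N : ℝ) ^ θ * (N : ℝ) ^ ε := by
    rw [← Real.rpow_add hNpos, hε]; congr 1; ring
  have hθpos : 0 < (N : ℝ) ^ θ := Real.rpow_pos_of_pos hNpos _
  have h3 : (N : ℝ) ^ ε ≤ K * Real.log N ^ k := by
    rw [h2] at h1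
    have h4 : (N : ℝ) ^ θ * (N : ℝ) ^ ε ≤ (N : ℝ) ^ θ * (K * Real.log N ^ k) := by
      calc _ ≤ K * ((N : ℝ) ^ θ * Real.log N ^ k) := h1
        _ = (N : ℝ) ^ θ * (K * Real.log N ^ k) := by ring
    exact le_of_mul_le_mul_left h4 hθpos
  have hεpos : 0 < (N : ℝ) ^ ε := Real.rpow_pos_of_pos hNpos _
  linarith

/-- **Corollaire 4.2 from Théorème 4.1** (Masser's zero estimate): the printed proof of p. 105 —
Corollaire 3.2 (`cor_3_2_holds`) gives `P_N`; by Liouville's inequality in `K = ℚ(exp⟨xᵢ, yⱼ⟩)`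
(`vanish_of_large`) `F_N` vanishes on `Y_M`, `M = ⌊N/(1 + ∑‖yⱼ‖)⌋` (so that `Y_M ⊆ B(0, N)`;
the source rescales to `∑|yⱼ| = 1` instead); Théorème 4.1 then gives
`(M/d)^{χ(Y,X)} ≤ deg P_N ≤ d N^{n/(d−n)} (log N)^{n+2}` for all large `N`, whence
`χ(Y, X) ≤ n/(d − n)` (`not_forall_rpow_le`).
[cite: Waldschmidt1981, §4 Corollaire 4.2 (p. 105)] -/
theorem cor_4_2_of_thm_4_1 (h41 : thm_4_1) : cor_4_2 := by
  intro n d l x y hx hy halg hnd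
  classical
  -- the algebraic data `α_{ij} = exp⟨xᵢ, yⱼ⟩`
  obtain ⟨G, idx, hidx⟩ : ∃ (G : AlgGens) (idx : Fin d → Fin l → G.ι),
      ∀ i j, G.a (idx i j) = cexp (x i ⬝ᵥ y j) :=
    ⟨⟨Fin d × Fin l, fun ij => cexp (x ij.1 ⬝ᵥ y ij.2), fun ij => halg ij.1 ij.2⟩,
      fun i j => (i, j), fun _ _ => rfl⟩
  -- the auxiliary polynomials of Corollaire 3.2
  obtain ⟨N₀, -, hPN⟩ := cor_3_2_holds x hnd
  -- constants
  have hdn : (0 : ℝ) < (d : ℝ) - n := by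
    have : (n : ℝ) < d := by exact_mod_cast hnd
    linarith
  have hdpos : (0 : ℝ) < d := by
    have : (n : ℝ) < d := by exact_mod_cast hnd
    linarith [(Nat.cast_nonneg n : (0 : ℝ) ≤ n)]
  have hθ0 : (0 : ℝ) ≤ (n : ℝ) / (d - n) := div_nonneg (Nat.cast_nonneg _) hdn.le
  obtain ⟨c', hc'⟩ : ∃ c' : ℝ, c' = 1 + ∑ j, ‖y j‖ := ⟨_, rfl⟩
  have hc'1 : 1 ≤ c' := by
    have : 0 ≤ ∑ j, ‖y j‖ := Finset.sum_nonneg fun _ _ => norm_nonneg _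
    rw [hc']; linarith
  have hc'pos : 0 < c' := by linarith
  obtain ⟨C, hC⟩ : ∃ C : ℝ,
      C = G.h * (d * l * (Real.log |(G.den : ℝ)| + Real.log G.M) + (d + 1)) := ⟨_, rfl⟩
  obtain ⟨N₁, hN₁⟩ : ∃ N₁ : ℝ, N₁ = max (max (N₀ : ℝ) 3) (max c' (Real.exp C + 1)) := ⟨_, rfl⟩
  -- the key inequality for `N ≥ N₁`
  have key : ∀ N : ℕ, N₁ ≤ N →
      (((⌊(N : ℝ) / c'⌋₊ : ℕ) : ℝ) / d) ^
          ((chi (Submodule.span ℤ (Set.range x)) (Submodule.span ℤ (Set.range y)) : ℚ) : ℝ) ≤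
        d * ((N : ℝ) ^ ((n : ℝ) / (d - n)) * Real.log N ^ (n + 2)) := by
    intro N hN
    rw [hN₁] at hN
    have hNN₀ : N₀ ≤ N := by
      have : (N₀ : ℝ) ≤ N := le_trans (by simp) hN
      exact_mod_cast this
    have hN3 : (3 : ℝ) ≤ N := le_trans (by simp) hN
    have hNc : c' ≤ N := le_trans (by simp) hN
    have hNe : Real.exp C + 1 ≤ N := le_trans (by simp) hN
    have hNpos : (0 : ℝ) < N := by linarith
    have hNC : G.h * (d * l * (Real.log |(G.den : ℝ)| + Real.log G.M) + (d + 1)) < Real.log N := by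
      rw [← hC, Real.lt_log_iff_exp_lt hNpos]; linarith
    obtain ⟨P, hP0, hdeg, hcoef, hsmall⟩ := hPN N hNN₀
    have hMle : ((⌊(N : ℝ) / c'⌋₊ : ℕ) : ℝ) ≤ N / c' := Nat.floor_le (by positivity)
    have hMN : ((⌊(N : ℝ) / c'⌋₊ : ℕ) : ℝ) ≤ N := hMle.trans (div_le_self hNpos.le hc'1)
    have hMy : ((⌊(N : ℝ) / c'⌋₊ : ℕ) : ℝ) * ∑ j, ‖y j‖ ≤ N :=
      calc ((⌊(N : ℝ) / c'⌋₊ : ℕ) : ℝ) * ∑ j, ‖y j‖ ≤ (N / c') * c' :=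
            mul_le_mul hMle (by rw [hc']; linarith) (Finset.sum_nonneg fun _ _ => norm_nonneg _)
              (by positivity)
        _ = N := div_mul_cancel₀ _ hc'pos.ne'
    have hMpos : 0 < ⌊(N : ℝ) / c'⌋₊ :=
      Nat.floor_pos.mpr (by rw [le_div_iff₀ hc'pos, one_mul]; exact hNc)
    -- `F_N` vanishes on `Y_M`, `M = ⌊N / c'⌋`
    have hvan : ∀ m : Fin l → ℕ, (∀ j, m j ≤ ⌊(N : ℝ) / c'⌋₊) →
        MvPolynomial.eval (fun i => cexp (x i ⬝ᵥ ∑ j, (m j : ℂ) • y j))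
          (map (Int.castRingHom ℂ) P) = 0 := by
      intro m hm
      rw [eval_map_intCast]
      exact vanish_of_large x y hnd G idx hidx hN3 P hP0 hdeg hcoef hsmall hNC hMN hMy m hm
    -- Théorème 4.1 for `P_N ∈ ℂ[T]`, `D = deg P_N ≥ 1`, on `Y_M`
    have hP'0 : map (Int.castRingHom ℂ) P ≠ 0 := fun h =>
      hP0 (map_injective (Int.castRingHom ℂ) Int.cast_injective (h.trans (map_zero _).symm))
    have hD1 : 1 ≤ (map (Int.castRingHom ℂ) P).totalDegree := by
      refine one_le_totalDegree_map x P hP0 0 (lt_of_le_of_lt (hsmall 0 (by simp)) ?_)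
      rw [Real.exp_lt_one_iff]
      have h1 : 0 < (N : ℝ) ^ ((d : ℝ) / (d - n)) := Real.rpow_pos_of_pos hNpos _
      have h2 : 0 < Real.log N := Real.log_pos (by linarith)
      have := mul_pos h1 (pow_pos h2 (d + 2))
      linarith
    have h := h41 x y hx hy (map (Int.castRingHom ℂ) P) (map (Int.castRingHom ℂ) P).totalDegree
      (⌊(N : ℝ) / c'⌋₊) hP'0 le_rfl hD1 hMpos hvan
    refine h.trans ?_
    have h1 : (map (Int.castRingHom ℂ) P).totalDegree = P.totalDegree := by
      simp only [totalDegree, support_map_of_injective P (f := Int.castRingHom ℂ) Int.cast_injective]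
    calc ((map (Int.castRingHom ℂ) P).totalDegree : ℝ) ≤ ∑ i, (P.degreeOf i : ℝ) := by
          rw [h1]
          exact_mod_cast totalDegree_le_sum_degreeOf P
      _ ≤ ∑ _i : Fin d, (N : ℝ) ^ ((n : ℝ) / (d - n)) * Real.log N ^ (n + 2) :=
          Finset.sum_le_sum fun i _ => (hdeg i).le
      _ = d * ((N : ℝ) ^ ((n : ℝ) / (d - n)) * Real.log N ^ (n + 2)) := by
          rw [Finset.sum_const, Finset.card_univ, Fintype.card_fin, nsmul_eq_mul]
  -- conclusion: `χ ≤ n/(d−n)`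
  by_contra hcon
  rw [not_le] at hcon
  have hθχ : (n : ℝ) / (d - n) <
      ((chi (Submodule.span ℤ (Set.range x)) (Submodule.span ℤ (Set.range y)) : ℚ) : ℝ) := by
    have h := (Rat.cast_lt (K := ℝ)).mpr hcon
    push_cast at h
    exact h
  exact not_forall_rpow_le hθ0 hθχ hc'pos hdpos key

end Waldschmidt1981

end Literature.NumberTheory.Transcendental

end
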